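import Literature.Computability.Complexity.RandomKSatWeights
import Mathlib.Analysis.Calculus.Deriv.Pow
import Mathlib.Analysis.Calculus.Deriv.Add
import Mathlib.Analysis.Calculus.Deriv.Mul
import HarnessLib

/-!
# The pair-correlation polynomial `F_λ` of random `k`-SAT: expansion at `α = 1/2` and calculus

Continuation of `RandomKSatWeights.lean` (AP2004 = D. Achlioptas, Y. Peres, J. Amer. Math. Soc. 17
(2004); arXiv:cs/0305009), §4 (proof of Lemma 4) and the pieces of §§5, 9 that are pure algebra of
`f(α) = F_λ(α) = (αλ² + α + 2λ(1-α))^k - 2(α + λ(1-α))^k + α^k` (`pairPoly k λ α`; AP write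
`λ = 1 - ε`).

## Results (all proved)

* `two_pow_mul_pairPoly_half_add` — **AP (27)**: `2^k F_λ(1/2 + x) = Σ_{j=0}^{k} C(k,j) (2x)^j c_j²`
  with `c_j = (1+λ)^{k-j}(1-λ)^j - 1` (AP: `(2-ε)^{k-j} ε^j - 1`);
* consequences: `pairPoly_half_le_of_nonneg` (`F(1/2) ≤ F(1/2+x)` for `x ≥ 0`),
  `pairPoly_half_add_mono` (monotone in `x ≥ 0`), `pairPoly_half_sub_le_half_add` — **AP Lemma 4**
  (`F(1/2 - x) ≤ F(1/2 + x)` for `x ≥ 0`), `pairPoly_pos_of_half_le` (`F > 0` on `[1/2, ∞)` when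
  `(1+λ)^k ≠ 1`);
* `two_pow_mul_pairPoly_half_add_le` — the upper bound behind AP (36)–(38) and (59): if
  `|c_j| ≤ 1` for `2 ≤ j ≤ k` then `2^k F_λ(1/2+x) ≤ c_0² + 2kx c_1² + ((1+2x)^k - 1 - 2kx)`,
  `x ≥ 0`;
* `pairPoly_nonneg` — `F_λ(α) ≥ 0` for `λ ≥ 0`, `α ∈ [0,1]` (the four literal types
  `(σ ⊨ ℓ, τ ⊨ ℓ) ∈ Bool × Bool` with weights `α/2, α/2, (1-α)/2, (1-α)/2`: `2^{-k}F_λ(α)` is the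
  expectation of a product of two non-negative weights);
* `hasDerivAt_pairPoly`, `hasDerivAt_deriv_pairPoly` — AP (28), (32):
  `F' = k[(1-λ)²A^{k-1} - 2(1-λ)B^{k-1} + α^{k-1}]`,
  `F'' = k(k-1)[(1-λ)⁴A^{k-2} - 2(1-λ)²B^{k-2} + α^{k-2}]` with `A = 2λ + α(1-λ)²`,
  `B = λ + α(1-λ)`, and the bound `pairPolyD2_le`: `F'' ≤ k²((1-λ)⁴ 2^{k-2} + α^{k-2})` for
  `0 ≤ λ ≤ 1`, `0 ≤ α ≤ 1`, `k ≥ 2`.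
-/

noncomputable section

namespace Literature.Computability.Complexity

open Finset
open scoped Classical

namespace RandomKSat

/-! ### The expansion at `α = 1/2` (AP (27)) -/

/-- **AP (27)**: `2^k F_λ(1/2 + x) = Σ_{j=0}^{k} C(k,j) (2x)^j ((1+λ)^{k-j}(1-λ)^j - 1)²`
(binomial expansion of the three powers of affine functions of `x`).
[cite: AchlioptasPeres2004, eq. (27) p. 11] -/
theorem two_pow_mul_pairPoly_half_add (k : ℕ) (lam x : ℝ) :
    2 ^ k * pairPoly k lam (1 / 2 + x) =
      ∑ j ∈ range (k + 1), (k.choose j : ℝ) * (2 * x) ^ j *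
        ((1 + lam) ^ (k - j) * (1 - lam) ^ j - 1) ^ 2 := by
  unfold pairPoly
  have hA : (1 / 2 + x) * lam ^ 2 + (1 / 2 + x) + 2 * lam * (1 - (1 / 2 + x)) =
      (2 * x * (1 - lam) ^ 2 + (1 + lam) ^ 2) / 2 := by ring
  have hB : (1 / 2 + x) + lam * (1 - (1 / 2 + x)) = (2 * x * (1 - lam) + (1 + lam)) / 2 := by ring
  have hC : (1 / 2 + x : ℝ) = (2 * x + 1) / 2 := by ring
  have e : ∀ u : ℝ, (2 : ℝ) ^ k * (u / 2) ^ k = u ^ k := fun u => by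
    rw [div_pow, mul_div_cancel₀ _ (pow_ne_zero k two_ne_zero)]
  rw [hA, hB]
  conv_lhs => rw [hC]
  rw [show (2 : ℝ) ^ k * (((2 * x * (1 - lam) ^ 2 + (1 + lam) ^ 2) / 2) ^ k -
      2 * ((2 * x * (1 - lam) + (1 + lam)) / 2) ^ k + ((2 * x + 1) / 2) ^ k) =
      2 ^ k * ((2 * x * (1 - lam) ^ 2 + (1 + lam) ^ 2) / 2) ^ k -
      2 * (2 ^ k * ((2 * x * (1 - lam) + (1 + lam)) / 2) ^ k) +
      2 ^ k * ((2 * x + 1) / 2) ^ k by ring, e, e, e, add_pow (2 * x * (1 - lam) ^ 2) ((1 + lam) ^ 2) k,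
    add_pow (2 * x * (1 - lam)) (1 + lam) k, add_pow (2 * x) 1 k, Finset.mul_sum,
    ← Finset.sum_sub_distrib, ← Finset.sum_add_distrib]
  refine Finset.sum_congr rfl fun j _ => ?_
  simp only [mul_pow, one_pow, mul_one, ← pow_mul]
  ring

/-- The `j = 0` term: `F_λ(1/2) = ((1+λ)^k - 1)²/2^k` (= `pairPoly_half`). [cite: AchlioptasPeres2004, eq. (25) p. 10] -/
theorem pairPoly_half' (k : ℕ) (lam : ℝ) :
    2 ^ k * pairPoly k lam (1 / 2) = ((1 + lam) ^ k - 1) ^ 2 := by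
  rw [pairPoly_half, mul_div_cancel₀ _ (pow_ne_zero k two_ne_zero)]

/-- Each term of AP (27) is non-negative for `x ≥ 0`. [cite: AchlioptasPeres2004, §4 p. 11] -/
theorem expansion_term_nonneg (k j : ℕ) (lam : ℝ) {x : ℝ} (hx : 0 ≤ x) :
    0 ≤ (k.choose j : ℝ) * (2 * x) ^ j * ((1 + lam) ^ (k - j) * (1 - lam) ^ j - 1) ^ 2 := by
  positivity

/-- `F_λ(1/2) ≤ F_λ(1/2 + x)` for `x ≥ 0` (all terms of AP (27) are non-negative and the `j = 0`
term is `2^k F(1/2)`). [cite: AchlioptasPeres2004, §4 p. 11 and (36) p. 13] -/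
theorem pairPoly_half_le_of_nonneg (k : ℕ) (lam : ℝ) {x : ℝ} (hx : 0 ≤ x) :
    pairPoly k lam (1 / 2) ≤ pairPoly k lam (1 / 2 + x) := by
  have h2 : (0 : ℝ) < 2 ^ k := pow_pos two_pos k
  rw [← mul_le_mul_iff_right₀ h2, pairPoly_half', two_pow_mul_pairPoly_half_add,
    Finset.sum_range_succ']
  simp only [Nat.choose_zero_right, Nat.cast_one, pow_zero, one_mul, Nat.sub_zero, mul_one]
  have : 0 ≤ ∑ j ∈ range k, (k.choose (j + 1) : ℝ) * (2 * x) ^ (j + 1) *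
      ((1 + lam) ^ (k - (j + 1)) * (1 - lam) ^ (j + 1) - 1) ^ 2 :=
    Finset.sum_nonneg fun j _ => expansion_term_nonneg k (j + 1) lam hx
  linarith

/-- Monotonicity: `F_λ(1/2 + x) ≤ F_λ(1/2 + x')` for `0 ≤ x ≤ x'` ("`f` is non-decreasing in
`[1/2, 1]`", AP p. 12). [cite: AchlioptasPeres2004, §5 p. 12] -/
theorem pairPoly_half_add_mono (k : ℕ) (lam : ℝ) {x x' : ℝ} (hx : 0 ≤ x) (hxx' : x ≤ x') :
    pairPoly k lam (1 / 2 + x) ≤ pairPoly k lam (1 / 2 + x') := by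
  have h2 : (0 : ℝ) < 2 ^ k := pow_pos two_pos k
  rw [← mul_le_mul_iff_right₀ h2, two_pow_mul_pairPoly_half_add, two_pow_mul_pairPoly_half_add]
  refine Finset.sum_le_sum fun j _ => ?_
  have : (2 * x) ^ j ≤ (2 * x') ^ j := pow_le_pow_left₀ (by linarith) (by linarith) j
  have hc : 0 ≤ (k.choose j : ℝ) := Nat.cast_nonneg _
  have hs : 0 ≤ ((1 + lam) ^ (k - j) * (1 - lam) ^ j - 1) ^ 2 := sq_nonneg _
  calc (k.choose j : ℝ) * (2 * x) ^ j * ((1 + lam) ^ (k - j) * (1 - lam) ^ j - 1) ^ 2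
      = (2 * x) ^ j * ((k.choose j : ℝ) * ((1 + lam) ^ (k - j) * (1 - lam) ^ j - 1) ^ 2) := by ring
    _ ≤ (2 * x') ^ j * ((k.choose j : ℝ) * ((1 + lam) ^ (k - j) * (1 - lam) ^ j - 1) ^ 2) :=
        mul_le_mul_of_nonneg_right this (mul_nonneg hc hs)
    _ = _ := by ring

/-- **AP Lemma 4**: `F_λ(1/2 - x) ≤ F_λ(1/2 + x)` for `x ≥ 0` (termwise `(-2x)^j ≤ (2x)^j`).
[cite: AchlioptasPeres2004, Lemma 4 (p. 11), proof §4] -/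
theorem pairPoly_half_sub_le_half_add (k : ℕ) (lam : ℝ) {x : ℝ} (hx : 0 ≤ x) :
    pairPoly k lam (1 / 2 - x) ≤ pairPoly k lam (1 / 2 + x) := by
  have h2 : (0 : ℝ) < 2 ^ k := pow_pos two_pos k
  rw [← mul_le_mul_iff_right₀ h2, sub_eq_add_neg, two_pow_mul_pairPoly_half_add,
    two_pow_mul_pairPoly_half_add]
  refine Finset.sum_le_sum fun j _ => ?_
  have : (2 * -x) ^ j ≤ (2 * x) ^ j := by
    rw [show (2 : ℝ) * -x = -(2 * x) by ring]
    calc (-(2 * x)) ^ j ≤ |(-(2 * x)) ^ j| := le_abs_self _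
      _ = (2 * x) ^ j := by rw [abs_pow, abs_neg, abs_of_nonneg (by linarith)]
  have hc : 0 ≤ (k.choose j : ℝ) := Nat.cast_nonneg _
  have hs : 0 ≤ ((1 + lam) ^ (k - j) * (1 - lam) ^ j - 1) ^ 2 := sq_nonneg _
  calc (k.choose j : ℝ) * (2 * -x) ^ j * ((1 + lam) ^ (k - j) * (1 - lam) ^ j - 1) ^ 2
      = (2 * -x) ^ j * ((k.choose j : ℝ) * ((1 + lam) ^ (k - j) * (1 - lam) ^ j - 1) ^ 2) := by ring
    _ ≤ (2 * x) ^ j * ((k.choose j : ℝ) * ((1 + lam) ^ (k - j) * (1 - lam) ^ j - 1) ^ 2) :=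
        mul_le_mul_of_nonneg_right this (mul_nonneg hc hs)
    _ = _ := by ring

/-- `F_λ(α) > 0` for `α ≥ 1/2` as soon as `(1+λ)^k ≠ 1` (e.g. `λ > 0`, `k ≥ 1`): the `j = 0` term
of AP (27) is `((1+λ)^k - 1)² > 0`. [cite: AchlioptasPeres2004, §5 p. 12 ("by (27), f(α) > 0")] -/
theorem pairPoly_pos_of_half_le {k : ℕ} {lam : ℝ} (hne : (1 + lam) ^ k ≠ 1) {α : ℝ}
    (hα : 1 / 2 ≤ α) : 0 < pairPoly k lam α := by
  have h := pairPoly_half_le_of_nonneg k lam (x := α - 1 / 2) (by linarith)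
  rw [show 1 / 2 + (α - 1 / 2) = α by ring] at h
  refine lt_of_lt_of_le ?_ h
  rw [pairPoly_half]
  have : 0 < ((1 + lam) ^ k - 1) ^ 2 := by
    have hne' : (1 + lam) ^ k - 1 ≠ 0 := sub_ne_zero.mpr hne
    positivity
  positivity

/-- The upper bound behind AP (36)–(38) and (59): if `|c_j| ≤ 1` for all `2 ≤ j ≤ k`
(`c_j = (1+λ)^{k-j}(1-λ)^j - 1`), then for `x ≥ 0`
`2^k F_λ(1/2 + x) ≤ c_0² + 2kx · c_1² + ((1 + 2x)^k - 1 - 2kx)` (the last bracket is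
`Σ_{j≥2} C(k,j)(2x)^j`). [cite: AchlioptasPeres2004, eq. (36)–(38) p. 13 and (59) p. 18] -/
theorem two_pow_mul_pairPoly_half_add_le {k : ℕ} (hk : 2 ≤ k) {lam : ℝ}
    (hc : ∀ j, 2 ≤ j → j ≤ k → |(1 + lam) ^ (k - j) * (1 - lam) ^ j - 1| ≤ 1) {x : ℝ}
    (hx : 0 ≤ x) :
    2 ^ k * pairPoly k lam (1 / 2 + x) ≤
      ((1 + lam) ^ k - 1) ^ 2 + 2 * k * x * ((1 + lam) ^ (k - 1) * (1 - lam) - 1) ^ 2 +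
        ((1 + 2 * x) ^ k - 1 - 2 * k * x) := by
  rw [two_pow_mul_pairPoly_half_add]
  obtain ⟨k', rfl⟩ : ∃ k', k = k' + 2 := ⟨k - 2, by omega⟩
  -- peel the terms `j = 0, 1`
  rw [Finset.sum_range_succ', Finset.sum_range_succ']
  -- the binomial tail `Σ_{j ≥ 2} C(k,j) (2x)^j = (1+2x)^k - 1 - 2kx`
  have hbinom : ∑ j ∈ range (k' + 1), ((k' + 2).choose (j + 1 + 1) : ℝ) * (2 * x) ^ (j + 1 + 1) =
      (1 + 2 * x) ^ (k' + 2) - 1 - 2 * (k' + 2 : ℕ) * x := by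
    have hb := add_pow (2 * x) 1 (k' + 2)
    rw [Finset.sum_range_succ', Finset.sum_range_succ'] at hb
    simp only [one_pow, mul_one, pow_zero, Nat.choose_zero_right, Nat.cast_one, zero_add,
      pow_one, Nat.choose_one_right] at hb
    rw [add_comm (2 * x) 1] at hb
    rw [hb]
    have e : ∑ j ∈ range (k' + 1), ((k' + 2).choose (j + 1 + 1) : ℝ) * (2 * x) ^ (j + 1 + 1) =
        ∑ j ∈ range (k' + 1), (2 * x) ^ (j + 1 + 1) * ((k' + 2).choose (j + 1 + 1) : ℝ) :=
      Finset.sum_congr rfl fun j _ => mul_comm _ _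
    rw [e]
    push_cast
    ring
  -- the tail of (27) is bounded by the binomial tail since `c_j² ≤ 1` for `j ≥ 2`
  have htail : ∑ j ∈ range (k' + 1), ((k' + 2).choose (j + 1 + 1) : ℝ) * (2 * x) ^ (j + 1 + 1) *
      ((1 + lam) ^ (k' + 2 - (j + 1 + 1)) * (1 - lam) ^ (j + 1 + 1) - 1) ^ 2 ≤
      ∑ j ∈ range (k' + 1), ((k' + 2).choose (j + 1 + 1) : ℝ) * (2 * x) ^ (j + 1 + 1) := by
    refine Finset.sum_le_sum fun j hj => ?_
    have hj' : j < k' + 1 := Finset.mem_range.mp hj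
    have h1 : ((1 + lam) ^ (k' + 2 - (j + 1 + 1)) * (1 - lam) ^ (j + 1 + 1) - 1) ^ 2 ≤ 1 := by
      have h := abs_le.mp (hc (j + 1 + 1) (by omega) (by omega))
      nlinarith
    have h0 : 0 ≤ ((k' + 2).choose (j + 1 + 1) : ℝ) * (2 * x) ^ (j + 1 + 1) := by positivity
    calc ((k' + 2).choose (j + 1 + 1) : ℝ) * (2 * x) ^ (j + 1 + 1) *
          ((1 + lam) ^ (k' + 2 - (j + 1 + 1)) * (1 - lam) ^ (j + 1 + 1) - 1) ^ 2
        ≤ ((k' + 2).choose (j + 1 + 1) : ℝ) * (2 * x) ^ (j + 1 + 1) * 1 :=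
          mul_le_mul_of_nonneg_left h1 h0
      _ = _ := mul_one _
  rw [hbinom] at htail
  simp only [Nat.choose_zero_right, Nat.cast_one, pow_zero, one_mul, mul_one, Nat.sub_zero,
    zero_add, Nat.choose_one_right, pow_one]
  push_cast at htail ⊢
  linarith [htail]

/-! ### Non-negativity of `F_λ` on `[0, 1]` -/

/-- `λ^s ≥ 1[s = 0]` in product form: for `λ ≥ 0` and any marking of the `k` positions,
`∏ (0 if marked else 1) ≤ ∏ (λ if marked else 1)`. [folklore] -/
theorem prod_ite_zero_one_le_prod_ite {k : ℕ} {lam : ℝ} (hl : 0 ≤ lam) (P : Fin k → Prop)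
    [DecidablePred P] :
    ∏ j, (if P j then (0 : ℝ) else 1) ≤ ∏ j, (if P j then lam else 1) := by
  by_cases h : ∃ j, P j
  · obtain ⟨j, hj⟩ := h
    rw [Finset.prod_eq_zero (Finset.mem_univ j) (if_pos hj : (if P j then (0 : ℝ) else 1) = 0)]
    exact Finset.prod_nonneg fun i _ => by split_ifs <;> [exact hl; exact zero_le_one]
  · push Not at h
    rw [Finset.prod_congr rfl fun j _ => if_neg (h j), Finset.prod_congr rfl fun j _ => if_neg (h j)]

/-- **`F_λ(α) ≥ 0` for `λ ≥ 0` and `0 ≤ α ≤ 1`.** With the four literal types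
`t = (σ ⊨ ℓ, τ ⊨ ℓ) ∈ Bool × Bool` weighted `μ(t) = α/2` if the two coordinates agree and
`(1-α)/2` otherwise (a probability vector), `2^{-k} F_λ(α) = Σ_t (∏ μ) · w_σ(t) w_τ(t)` with
`w = ∏ a - ∏ b ≥ 0` — the continuous-`α` version of the pair computation AP (18).
[cite: AchlioptasPeres2004, §3.2 eq. (18) p. 9 (probabilistic meaning of f)] -/
theorem pairPoly_nonneg (k : ℕ) {lam α : ℝ} (hl : 0 ≤ lam) (h0 : 0 ≤ α) (h1 : α ≤ 1) :
    0 ≤ pairPoly k lam α := by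
  -- type weights `μ`, per-type factors `aσ, bσ, aτ, bτ` (written inline):
  --   μ t = α/2 if t.1 = t.2 else (1-α)/2;  aσ t = λ|1 as t.1;  bσ t = 0|1 as t.1; same with t.2.
  -- the four one-literal sums
  have s1 : ∑ t : Bool × Bool, (if t.1 = t.2 then α / 2 else (1 - α) / 2) *
      ((if t.1 = true then lam else 1) * (if t.2 = true then lam else 1)) =
      (α * lam ^ 2 + α + 2 * lam * (1 - α)) / 2 := by
    rw [Fintype.sum_prod_type]; simp only [Fintype.sum_bool]; simp; ring
  have s2 : ∑ t : Bool × Bool, (if t.1 = t.2 then α / 2 else (1 - α) / 2) *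
      ((if t.1 = true then lam else 1) * (if t.2 = true then (0 : ℝ) else 1)) =
      (α + lam * (1 - α)) / 2 := by
    rw [Fintype.sum_prod_type]; simp only [Fintype.sum_bool]; simp; ring
  have s3 : ∑ t : Bool × Bool, (if t.1 = t.2 then α / 2 else (1 - α) / 2) *
      ((if t.1 = true then (0 : ℝ) else 1) * (if t.2 = true then lam else 1)) =
      (α + lam * (1 - α)) / 2 := by
    rw [Fintype.sum_prod_type]; simp only [Fintype.sum_bool]; simp; ring
  have s4 : ∑ t : Bool × Bool, (if t.1 = t.2 then α / 2 else (1 - α) / 2) *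
      ((if t.1 = true then (0 : ℝ) else 1) * (if t.2 = true then (0 : ℝ) else 1)) = α / 2 := by
    rw [Fintype.sum_prod_type]; simp only [Fintype.sum_bool]; simp
  -- the expectation of the product of the two weights is `2^{-k} F`
  have key : ∑ T : Fin k → Bool × Bool, (∏ j, (if (T j).1 = (T j).2 then α / 2 else (1 - α) / 2)) *
      (((∏ j, (if (T j).1 = true then lam else 1)) - ∏ j, (if (T j).1 = true then (0 : ℝ) else 1)) *
        ((∏ j, (if (T j).2 = true then lam else 1)) - ∏ j, (if (T j).2 = true then (0 : ℝ) else 1))) =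
      pairPoly k lam α / 2 ^ k := by
    have expand : ∀ T : Fin k → Bool × Bool,
        (∏ j, (if (T j).1 = (T j).2 then α / 2 else (1 - α) / 2)) *
        (((∏ j, (if (T j).1 = true then lam else 1)) - ∏ j, (if (T j).1 = true then (0 : ℝ) else 1)) *
          ((∏ j, (if (T j).2 = true then lam else 1)) - ∏ j, (if (T j).2 = true then (0 : ℝ) else 1))) =
        (∏ j, (if (T j).1 = (T j).2 then α / 2 else (1 - α) / 2) *
            ((if (T j).1 = true then lam else 1) * (if (T j).2 = true then lam else 1))) -
          (∏ j, (if (T j).1 = (T j).2 then α / 2 else (1 - α) / 2) *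
            ((if (T j).1 = true then lam else 1) * (if (T j).2 = true then (0 : ℝ) else 1))) -
          (∏ j, (if (T j).1 = (T j).2 then α / 2 else (1 - α) / 2) *
            ((if (T j).1 = true then (0 : ℝ) else 1) * (if (T j).2 = true then lam else 1))) +
          ∏ j, (if (T j).1 = (T j).2 then α / 2 else (1 - α) / 2) *
            ((if (T j).1 = true then (0 : ℝ) else 1) * (if (T j).2 = true then (0 : ℝ) else 1)) := by
      intro T
      simp only [Finset.prod_mul_distrib]
      ring
    simp only [expand, Finset.sum_add_distrib, Finset.sum_sub_distrib]
    rw [← Fintype.sum_pow (fun t : Bool × Bool => (if t.1 = t.2 then α / 2 else (1 - α) / 2) *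
          ((if t.1 = true then lam else 1) * (if t.2 = true then lam else 1))) k,
      ← Fintype.sum_pow (fun t : Bool × Bool => (if t.1 = t.2 then α / 2 else (1 - α) / 2) *
          ((if t.1 = true then lam else 1) * (if t.2 = true then (0 : ℝ) else 1))) k,
      ← Fintype.sum_pow (fun t : Bool × Bool => (if t.1 = t.2 then α / 2 else (1 - α) / 2) *
          ((if t.1 = true then (0 : ℝ) else 1) * (if t.2 = true then lam else 1))) k,
      ← Fintype.sum_pow (fun t : Bool × Bool => (if t.1 = t.2 then α / 2 else (1 - α) / 2) *
          ((if t.1 = true then (0 : ℝ) else 1) * (if t.2 = true then (0 : ℝ) else 1))) k,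
      s1, s2, s3, s4]
    unfold pairPoly
    rw [div_pow, div_pow, div_pow]
    field_simp
    ring
  have hμ0 : ∀ t : Bool × Bool, 0 ≤ (if t.1 = t.2 then α / 2 else (1 - α) / 2) := by
    intro t; split_ifs <;> linarith
  have hpos : 0 ≤ ∑ T : Fin k → Bool × Bool,
      (∏ j, (if (T j).1 = (T j).2 then α / 2 else (1 - α) / 2)) *
      (((∏ j, (if (T j).1 = true then lam else 1)) - ∏ j, (if (T j).1 = true then (0 : ℝ) else 1)) *
        ((∏ j, (if (T j).2 = true then lam else 1)) - ∏ j, (if (T j).2 = true then (0 : ℝ) else 1))) := by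
    refine Finset.sum_nonneg fun T _ => mul_nonneg (Finset.prod_nonneg fun j _ => hμ0 _) ?_
    refine mul_nonneg ?_ ?_
    · have := prod_ite_zero_one_le_prod_ite hl (fun j => (T j).1 = true)
      linarith
    · have := prod_ite_zero_one_le_prod_ite hl (fun j => (T j).2 = true)
      linarith
  rw [key] at hpos
  have h2 : (0 : ℝ) < 2 ^ k := pow_pos two_pos k
  exact (div_nonneg_iff.mp hpos).elim (fun h => h.1) fun h => absurd h.2 (not_le.mpr h2)

/-! ### Derivatives in `α` (AP (28), (32)) -/

/-- `F'(α) = k[(1-λ)² A^{k-1} - 2(1-λ) B^{k-1} + α^{k-1}]`, `A = 2λ + α(1-λ)²`, `B = λ + α(1-λ)`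
(AP (28): `f' = k[(2-2ε+αε²)^{k-1}ε² - 2(1-ε+αε)^{k-1}ε + α^{k-1}]`).
[cite: AchlioptasPeres2004, eq. (28) p. 11] -/
theorem hasDerivAt_pairPoly (k : ℕ) (lam α : ℝ) :
    HasDerivAt (fun a => pairPoly k lam a)
      (k * ((1 - lam) ^ 2 * (2 * lam + α * (1 - lam) ^ 2) ^ (k - 1) -
        2 * (1 - lam) * (lam + α * (1 - lam)) ^ (k - 1) + α ^ (k - 1))) α := by
  have hA : HasDerivAt (fun a : ℝ => a * lam ^ 2 + a + 2 * lam * (1 - a)) ((1 - lam) ^ 2) α := by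
    have := (((hasDerivAt_id' α).mul_const (lam ^ 2)).fun_add (hasDerivAt_id' α)).fun_add
      (((hasDerivAt_id' α).const_sub 1).const_mul (2 * lam))
    exact this.congr_deriv (by ring)
  have hB : HasDerivAt (fun a : ℝ => a + lam * (1 - a)) (1 - lam) α := by
    have := (hasDerivAt_id' α).fun_add (((hasDerivAt_id' α).const_sub 1).const_mul lam)
    exact this.congr_deriv (by ring)
  have h := ((hA.fun_pow k).fun_sub ((hB.fun_pow k).const_mul 2)).fun_add
    ((hasDerivAt_id α).fun_pow k)
  have hfun : (fun a => pairPoly k lam a) = fun a : ℝ =>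
      (a * lam ^ 2 + a + 2 * lam * (1 - a)) ^ k - 2 * (a + lam * (1 - a)) ^ k + id a ^ k := by
    funext a; simp only [pairPoly, id]
  rw [hfun]
  refine h.congr_deriv ?_
  simp only [id]
  ring

/-- `F''(α) = k(k-1)[(1-λ)⁴ A^{k-2} - 2(1-λ)² B^{k-2} + α^{k-2}]` (AP (32), first line).
[cite: AchlioptasPeres2004, eq. (32) p. 12] -/
theorem hasDerivAt_deriv_pairPoly (k : ℕ) (lam α : ℝ) :
    HasDerivAt (fun a => (k : ℝ) * ((1 - lam) ^ 2 * (2 * lam + a * (1 - lam) ^ 2) ^ (k - 1) -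
        2 * (1 - lam) * (lam + a * (1 - lam)) ^ (k - 1) + a ^ (k - 1)))
      (k * (k - 1 : ℕ) * ((1 - lam) ^ 4 * (2 * lam + α * (1 - lam) ^ 2) ^ (k - 2) -
        2 * (1 - lam) ^ 2 * (lam + α * (1 - lam)) ^ (k - 2) + α ^ (k - 2))) α := by
  have hA : HasDerivAt (fun a : ℝ => 2 * lam + a * (1 - lam) ^ 2) ((1 - lam) ^ 2) α := by
    have := ((hasDerivAt_id α).mul_const ((1 - lam) ^ 2)).const_add (2 * lam)
    simpa using this
  have hB : HasDerivAt (fun a : ℝ => lam + a * (1 - lam)) (1 - lam) α := by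
    have := ((hasDerivAt_id α).mul_const (1 - lam)).const_add lam
    simpa using this
  have h := ((((hA.fun_pow (k - 1)).const_mul ((1 - lam) ^ 2)).fun_sub
    (((hB.fun_pow (k - 1)).const_mul (2 * (1 - lam))))).fun_add
      ((hasDerivAt_id α).fun_pow (k - 1))).const_mul (k : ℝ)
  have hk : (k - 1 - 1 : ℕ) = k - 2 := by omega
  rw [hk] at h
  have hfun : (fun a => (k : ℝ) * ((1 - lam) ^ 2 * (2 * lam + a * (1 - lam) ^ 2) ^ (k - 1) -
        2 * (1 - lam) * (lam + a * (1 - lam)) ^ (k - 1) + a ^ (k - 1))) =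
      fun a : ℝ => (k : ℝ) * ((1 - lam) ^ 2 * (2 * lam + a * (1 - lam) ^ 2) ^ (k - 1) -
        2 * (1 - lam) * (lam + a * (1 - lam)) ^ (k - 1) + id a ^ (k - 1)) := by
    funext a; simp only [id]
  rw [hfun]
  refine h.congr_deriv ?_
  simp only [id]
  ring

/-- **AP (32), second line**: for `0 ≤ λ ≤ 1`, `0 ≤ α ≤ 1` and `k ≥ 2`,
`F''(α) ≤ k² ((1-λ)⁴ 2^{k-2} + α^{k-2})` (drop the negative middle term, `A ≤ 2`, `k(k-1) ≤ k²`).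
[cite: AchlioptasPeres2004, eq. (32) p. 12] -/
theorem pairPolyD2_le {k : ℕ} (hk : 2 ≤ k) {lam α : ℝ} (hl0 : 0 ≤ lam) (hl1 : lam ≤ 1)
    (h0 : 0 ≤ α) (h1 : α ≤ 1) :
    (k : ℝ) * (k - 1 : ℕ) * ((1 - lam) ^ 4 * (2 * lam + α * (1 - lam) ^ 2) ^ (k - 2) -
        2 * (1 - lam) ^ 2 * (lam + α * (1 - lam)) ^ (k - 2) + α ^ (k - 2)) ≤
      (k : ℝ) ^ 2 * ((1 - lam) ^ 4 * 2 ^ (k - 2) + α ^ (k - 2)) := by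
  have hA0 : 0 ≤ 2 * lam + α * (1 - lam) ^ 2 := by positivity
  have hA2 : 2 * lam + α * (1 - lam) ^ 2 ≤ 2 := by nlinarith
  have hB0 : 0 ≤ lam + α * (1 - lam) := by nlinarith
  have hApow : (2 * lam + α * (1 - lam) ^ 2) ^ (k - 2) ≤ 2 ^ (k - 2) := pow_le_pow_left₀ hA0 hA2 _
  have hmid : 0 ≤ 2 * (1 - lam) ^ 2 * (lam + α * (1 - lam)) ^ (k - 2) := by positivity
  have hk1 : ((k - 1 : ℕ) : ℝ) ≤ k := by exact_mod_cast Nat.sub_le k 1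
  have hkk : (k : ℝ) * (k - 1 : ℕ) ≤ (k : ℝ) ^ 2 := by
    rw [sq]; exact mul_le_mul_of_nonneg_left hk1 (Nat.cast_nonneg k)
  have hbr : (1 - lam) ^ 4 * (2 * lam + α * (1 - lam) ^ 2) ^ (k - 2) -
        2 * (1 - lam) ^ 2 * (lam + α * (1 - lam)) ^ (k - 2) + α ^ (k - 2) ≤
      (1 - lam) ^ 4 * 2 ^ (k - 2) + α ^ (k - 2) := by
    have := mul_le_mul_of_nonneg_left hApow (pow_nonneg (by linarith : (0 : ℝ) ≤ 1 - lam) 4)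
    linarith
  have hrhs0 : 0 ≤ (1 - lam) ^ 4 * 2 ^ (k - 2) + α ^ (k - 2) := by positivity
  calc (k : ℝ) * (k - 1 : ℕ) * ((1 - lam) ^ 4 * (2 * lam + α * (1 - lam) ^ 2) ^ (k - 2) -
        2 * (1 - lam) ^ 2 * (lam + α * (1 - lam)) ^ (k - 2) + α ^ (k - 2))
      ≤ (k : ℝ) * (k - 1 : ℕ) * ((1 - lam) ^ 4 * 2 ^ (k - 2) + α ^ (k - 2)) :=
        mul_le_mul_of_nonneg_left hbr (by positivity)
    _ ≤ (k : ℝ) ^ 2 * ((1 - lam) ^ 4 * 2 ^ (k - 2) + α ^ (k - 2)) :=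
        mul_le_mul_of_nonneg_right hkk hrhs0

end RandomKSat

end Literature.Computability.Complexity

end
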